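import Summits.ResolutionOfSingularities.ResolutionOfSingularities.Theorems.FrobeniusLadderFInjectiveMacaulayficationPConeFedderData
import Summits.ResolutionOfSingularities.ResolutionOfSingularities.Theorems.FrobeniusLadderFInjectiveMacaulayficationCIFedderAtMaximalIdeal
import Summits.ResolutionOfSingularities.ResolutionOfSingularities.Theorems.FrobeniusLadderFInjectiveMacaulayficationFrobeniusPowerOfFedderAt
import Summits.ResolutionOfSingularities.ResolutionOfSingularities.Theorems.FrobeniusLadderFInjectiveMacaulayficationThreefoldG3Prime
import Literature.AlgebraicGeometry.Resolution.CohenMacaulayUnmixed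
import Mathlib.RingTheory.MvPolynomial.IrreducibleQuadratic
import Mathlib.RingTheory.Prime
import HarnessLib

/-!
# The clause off the vertex for the cone over idea-2's residual point `P` (hoffᵍ of the graded-domain engine at `P`, `p = 5`)
# (crux `FInjectiveMacaulayfication`, (H4-gd) calibration data G6ᵍ-P)

Support file for crux stmt-ResolutionOfSingularities-15315 (`FrobeniusLadder.FInjectiveMacaulayfication`), chain w45a,
seat res-L1-w45a-stub-4 (res-L1-w45a-plan-1 R8.1: K-P + `…PConeOffVertex`). [OURS · L1 W4.5a] — NOT a statement of the
manuscript [claim: Hironaka2017]; AI-written, weaker than expert review.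

`X = Spec k[x,y,w,Z,U]/(F₁,F₂)`, `F₁ = x²+y³−wU`, `F₂ = Z²+wU³+w³`, `char k = 5`. MAIN THEOREM `pCone_offVertex_clause_char5`:
at every closed point of `X` other than the vertex (a maximal ideal missing some variable) the local ring satisfies the per-stalk
clause of the crux (every system of parameters weakly regular and generating a Frobenius closed ideal) — the hypothesis `hoffᵍ`
of `StubsV19.stub_gradedDomainConeFiModel` / `GradedDomainConeFiModel` (stub-2) at `G = {F₁, F₂}`, written over
`Ideal.ofList [F₁, F₂] = Ideal.span {r | r ∈ [F₁, F₂]}`. The singular locus of `X` is NOT the vertex (kit job j269358: it is the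
union of the cones `L = {x=y=w=Z=0}` and `C′ = {w=Z=U=0, x²+y³=0}`), so regularity is not available there; the proof is Fedder's
criterion for the complete intersection `(F₁, F₂)` at EVERY off-vertex point:

* §1 `prime_F₁` (`F₁` linear in `U` with coprime coefficients, `MvPolynomial.irreducible_mul_X_add`), `F₁_not_dvd_F₂`;
* §2 `ringKrullDim_stalk_add_two` — the expected-dimension binder `dim (k[X]/(F₁,F₂))_Q + 2 = 5`: two non-zero-divisor cuts in
  `k[X]_P` (`F₁` prime and `F₁ ∤ F₂` make `F₂` regular modulo `F₁`), `DoubleQuot` and stub-6's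
  `CIFedderAtMaximalIdeal.nonempty_quotLocalizationEquiv`;
* §3 `fedder_at_offVertex_point` — at the residue point `b = (x̄ᵢ) ∈ (k[X]/P)⁵` of an off-vertex closed point one has
  `b_U ≠ 0 ∨ b_w ≠ 0 ∨ b_x ≠ 0` (else `F₁(b) = b_y³`, `F₂(b) = b_Z²` force `b = 0`), so one of the three witnesses of
  `…PConeFedderData` applies, and the residue-point dictionary (C3a) `FrobeniusPowerOfFedderAt.frobeniusPower_of_fedderAt` gives
  `(F₁F₂)⁴ ∉ P^[5]`;
* §4 `pCone_offVertex_clause_char5` := stub-6's `CIFedderAtMaximalIdeal.ci_fedderAtMaximalIdeal` (Fedder for complete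
  intersections at a closed point, p500646/`CIFedder.fedder_ci_clause`) on these inputs.

No definitions, no named facts; glue. [cite: Fedder1983, Prop. 1.7, Thm. 1.12 and Prop. 2.1 (criterion); the specimen is OURS]
-/

-- single-problem summit: the doubled namespace component is forced
set_option linter.dupNamespace false

noncomputable section

namespace Summit.ResolutionOfSingularities.ResolutionOfSingularities.Theorems.FInjectiveMacaulayfication.PConeOffVertex

open MvPolynomial IsLocalRing Literature.RingTheory.TightClosure Literature.AlgebraicGeometry.Resolution
open Summit.ResolutionOfSingularities.ResolutionOfSingularities.Theorems.FInjectiveMacaulayfication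
open ThreefoldG3Prime

/-! ## §1 `F₁` is prime and does not divide `F₂` -/

section Algebra

variable {k : Type} [Field k]

/-- `F₁ = x²+y³−wU` is prime in `k[x,y,w,Z,U]`: `−F₁ = w·U − (x²+y³)` is linear in `U` with coefficient `w` (irreducible) not
dividing `x²+y³`. [folklore] -/
theorem prime_F₁ (F₁ : MvPolynomial (Fin 5) k) (hF₁ : F₁ = X 0 ^ 2 + X 1 ^ 3 - X 2 * X 4) : Prime F₁ := by
  have hlin : -F₁ = X 2 * X 4 + (-(X 0 ^ 2 + X 1 ^ 3)) := by rw [hF₁]; ring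
  -- `X 2` is irreducible
  have hirrX : Irreducible (X 2 : MvPolynomial (Fin 5) k) := by
    have h := irreducible_mul_X_add (1 : MvPolynomial (Fin 5) k) 0 2 one_ne_zero
      (by rw [vars_one]; exact Finset.notMem_empty _) (by simp)
      isRelPrime_one_left
    rwa [one_mul, add_zero] at h
  -- `X 2 ∤ -(x²+y³)`: evaluate at `(1,0,0,0,0)`
  have hndvd : ¬ (X 2 : MvPolynomial (Fin 5) k) ∣ -(X 0 ^ 2 + X 1 ^ 3) := by
    intro h
    have h1 := map_dvd (MvPolynomial.eval (![1, 0, 0, 0, 0] : Fin 5 → k)) h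
    have ha : MvPolynomial.eval (![1, 0, 0, 0, 0] : Fin 5 → k) (X 2) = 0 := by simp
    have hc : MvPolynomial.eval (![1, 0, 0, 0, 0] : Fin 5 → k) (-(X 0 ^ 2 + X 1 ^ 3)) = -1 := by simp
    rw [ha, hc, zero_dvd_iff] at h1
    exact one_ne_zero (neg_eq_zero.mp h1)
  have hrel : IsRelPrime (X 2 : MvPolynomial (Fin 5) k) (-(X 0 ^ 2 + X 1 ^ 3)) :=
    hirrX.isRelPrime_iff_not_dvd.mpr hndvd
  have h42 : (4 : Fin 5) ≠ 2 := by decide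
  have h40 : (4 : Fin 5) ≠ 0 := by decide
  have h41 : (4 : Fin 5) ≠ 1 := by decide
  have hva : (4 : Fin 5) ∉ (X 2 : MvPolynomial (Fin 5) k).vars := notMem_vars_X h42
  have hvc : (4 : Fin 5) ∉ (-(X 0 ^ 2 + X 1 ^ 3) : MvPolynomial (Fin 5) k).vars := by
    rw [vars_neg]
    exact notMem_vars_add (notMem_vars_pow (notMem_vars_X h40) 2) (notMem_vars_pow (notMem_vars_X h41) 3)
  have hirr : Irreducible (-F₁) := by
    rw [hlin]
    exact irreducible_mul_X_add _ _ 4 hirrX.ne_zero hva hvc hrel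
  have hprime : Prime (-F₁) := UniqueFactorizationMonoid.irreducible_iff_prime.mp hirr
  simpa using hprime.neg

/-- `F₁ ∤ F₂`: at `(0,0,0,1,0)` one has `F₁ = 0`, `F₂ = 1`. [folklore] -/
theorem F₁_not_dvd_F₂ (F₁ F₂ : MvPolynomial (Fin 5) k)
    (hF₁ : F₁ = X 0 ^ 2 + X 1 ^ 3 - X 2 * X 4) (hF₂ : F₂ = X 3 ^ 2 + X 2 * X 4 ^ 3 + X 2 ^ 3) : ¬ F₁ ∣ F₂ := by
  intro h
  have h1 := map_dvd (MvPolynomial.eval (![0, 0, 0, 1, 0] : Fin 5 → k)) h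
  have ha : MvPolynomial.eval (![0, 0, 0, 1, 0] : Fin 5 → k) F₁ = 0 := by simp [hF₁]
  have hc : MvPolynomial.eval (![0, 0, 0, 1, 0] : Fin 5 → k) F₂ = 1 := by simp [hF₂]
  rw [ha, hc, zero_dvd_iff] at h1
  exact one_ne_zero h1

/-- `F₁` and `F₂` lie in the ideal of the variables (the vertex). [folklore] -/
theorem F₁_F₂_ne_zero (F₁ F₂ : MvPolynomial (Fin 5) k)
    (hF₁ : F₁ = X 0 ^ 2 + X 1 ^ 3 - X 2 * X 4) (hF₂ : F₂ = X 3 ^ 2 + X 2 * X 4 ^ 3 + X 2 ^ 3) : F₁ ≠ 0 ∧ F₂ ≠ 0 := by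
  refine ⟨(prime_F₁ F₁ hF₁).ne_zero, fun h => ?_⟩
  have h1 := congrArg (MvPolynomial.eval (![0, 0, 0, 1, 0] : Fin 5 → k)) h
  simp [hF₂] at h1

end Algebra

/-! ## §2 The expected dimension: `dim (k[X]/(F₁,F₂))_Q + 2 = 5` -/

section Dimension

variable {k : Type} [Field k]

/-- In a local ring, the class modulo an ideal `I ⊆ 𝔪` of an element of `𝔪` is in the maximal ideal of `R ⧸ I`. [folklore] -/
theorem mk_mem_maximalIdeal {R : Type} [CommRing R] [IsLocalRing R] (I : Ideal R) (hI : I ≤ maximalIdeal R)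
    [IsLocalRing (R ⧸ I)] {x : R} (hx : x ∈ maximalIdeal R) : Ideal.Quotient.mk I x ∈ maximalIdeal (R ⧸ I) := by
  rw [IsLocalRing.mem_maximalIdeal, mem_nonunits_iff]
  intro hu
  obtain ⟨y, hy⟩ := hu.exists_right_inv
  obtain ⟨y₀, rfl⟩ := Ideal.Quotient.mk_surjective y
  have hy' : x * y₀ - 1 ∈ I := by
    rw [← Ideal.Quotient.eq, map_mul, map_one]
    exact hy
  have h1 : (1 : R) ∈ maximalIdeal R := by
    have h := Ideal.sub_mem _ (Ideal.mul_mem_right y₀ _ hx) (hI hy')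
    rwa [sub_sub_cancel] at h
  exact (maximalIdeal.isMaximal R).ne_top (Ideal.eq_top_of_isUnit_mem _ h1 isUnit_one)

/-- **Two non-zero-divisor cuts** (abstract): in a Noetherian local domain `R`, for `f₁ ≠ 0` in `𝔪` generating a prime ideal and
`f₂ ∈ 𝔪 ∖ (f₁)`, `dim R/(f₁,f₂) + 2 = dim R`. [folklore] -/
theorem ringKrullDim_two_cuts {R : Type} [CommRing R] [IsNoetherianRing R] [IsLocalRing R] [IsDomain R] (f₁ f₂ : R)
    (hf₁m : f₁ ∈ maximalIdeal R) (hf₂m : f₂ ∈ maximalIdeal R) (hf₁0 : f₁ ≠ 0)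
    (hp : (Ideal.span {f₁}).IsPrime) (hnot : f₂ ∉ Ideal.span {f₁}) :
    ringKrullDim (R ⧸ (Ideal.span {f₁} ⊔ Ideal.span {f₂})) + 1 + 1 = ringKrullDim R := by
  have hreg₁ : IsSMulRegular R f₁ :=
    (isRegular_iff_mem_nonZeroDivisors.mpr (mem_nonZeroDivisors_of_ne_zero hf₁0)).left.isSMulRegular
  have hdim₁ := ringKrullDim_quotient_span_singleton_succ_eq_ringKrullDim hreg₁ hf₁m
  obtain ⟨hnt, hloc⟩ := isLocalRing_quotient_span_singleton hf₁m
  haveI := hnt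
  haveI := hloc
  haveI := hp
  haveI : IsDomain (R ⧸ Ideal.span {f₁}) := Ideal.Quotient.isDomain _
  have hg0 : Ideal.Quotient.mk (Ideal.span {f₁}) f₂ ≠ 0 := fun h => hnot (Ideal.Quotient.eq_zero_iff_mem.mp h)
  have hgm : Ideal.Quotient.mk (Ideal.span {f₁}) f₂ ∈ maximalIdeal (R ⧸ Ideal.span {f₁}) :=
    mk_mem_maximalIdeal _ ((Ideal.span_singleton_le_iff_mem _).mpr hf₁m) hf₂m
  have hreg₂ : IsSMulRegular (R ⧸ Ideal.span {f₁}) (Ideal.Quotient.mk (Ideal.span {f₁}) f₂) :=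
    (isRegular_iff_mem_nonZeroDivisors.mpr (mem_nonZeroDivisors_of_ne_zero hg0)).left.isSMulRegular
  have hdim₂ := ringKrullDim_quotient_span_singleton_succ_eq_ringKrullDim hreg₂ hgm
  have hgmap : Ideal.span {Ideal.Quotient.mk (Ideal.span {f₁}) f₂} =
      (Ideal.span {f₂}).map (Ideal.Quotient.mk (Ideal.span {f₁})) := by
    rw [Ideal.map_span, Set.image_singleton]
  have e₁ : (R ⧸ Ideal.span {f₁}) ⧸ Ideal.span {Ideal.Quotient.mk (Ideal.span {f₁}) f₂} ≃+*
      R ⧸ (Ideal.span {f₁} ⊔ Ideal.span {f₂}) :=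
    (Ideal.quotEquivOfEq hgmap).trans (DoubleQuot.quotQuotEquivQuotSup _ _)
  rw [← ringKrullDim_eq_of_ringEquiv e₁, hdim₂, hdim₁]

/-- **The expected-dimension binder**: for every maximal ideal `Q` of `k[x,y,w,Z,U]/(F₁,F₂)` the local ring has dimension `3`,
in the additive form `dim + 2 = 5` consumed by `CIFedderAtMaximalIdeal.ci_fedderAtMaximalIdeal`: two cuts
(`ringKrullDim_two_cuts`) in the `5`-dimensional local domain `k[X]_P`, `P = Q ∩ k[X]` — `F₁ ≠ 0`, `(F₁)` prime and `⊆ P`,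
`F₂ ∉ F₁·k[X]_P` because `F₁ ∤ F₂` — and `k[X]_P/(F₁,F₂) ≅ (k[X]/(F₁,F₂))_Q`. [folklore] -/
theorem ringKrullDim_stalk_add_two (F₁ F₂ : MvPolynomial (Fin 5) k)
    (hF₁ : F₁ = X 0 ^ 2 + X 1 ^ 3 - X 2 * X 4) (hF₂ : F₂ = X 3 ^ 2 + X 2 * X 4 ^ 3 + X 2 ^ 3)
    (Q : Ideal (MvPolynomial (Fin 5) k ⧸ Ideal.ofList [F₁, F₂])) [Q.IsMaximal] :
    ringKrullDim (Localization.AtPrime Q) + (([F₁, F₂].length : ℕ) : WithBot ℕ∞) = ((5 : ℕ) : WithBot ℕ∞) := by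
  haveI hPmax : (Q.comap (Ideal.Quotient.mk (Ideal.ofList [F₁, F₂]))).IsMaximal :=
    Ideal.comap_isMaximal_of_surjective _ Ideal.Quotient.mk_surjective
  set P : Ideal (MvPolynomial (Fin 5) k) := Q.comap (Ideal.Quotient.mk (Ideal.ofList [F₁, F₂])) with hP
  -- `R = k[X]_P` is a `5`-dimensional Noetherian local domain
  have hdimR : ringKrullDim (Localization.AtPrime P) = ((5 : ℕ) : WithBot ℕ∞) := by
    rw [IsLocalization.AtPrime.ringKrullDim_eq_height P (Localization.AtPrime P), MvPolynomial.height_eq_of_isMaximal k 5 P]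
    norm_cast
  haveI : IsDomain (Localization.AtPrime P) := IsLocalization.isDomain_localization P.primeCompl_le_nonZeroDivisors
  haveI : IsNoetherianRing (Localization.AtPrime P) :=
    IsLocalization.isNoetherianRing P.primeCompl (Localization.AtPrime P) inferInstance
  have hinj : Function.Injective (algebraMap (MvPolynomial (Fin 5) k) (Localization.AtPrime P)) :=
    IsLocalization.injective (Localization.AtPrime P) P.primeCompl_le_nonZeroDivisors
  have hsub : Ideal.ofList [F₁, F₂] ≤ P := fun r hr => by
    rw [hP, Ideal.mem_comap, Ideal.Quotient.eq_zero_iff_mem.mpr hr]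
    exact Q.zero_mem
  have hF₁P : F₁ ∈ P := hsub (Ideal.subset_span (by simp))
  have hF₂P : F₂ ∈ P := hsub (Ideal.subset_span (by simp))
  have hfm : algebraMap _ (Localization.AtPrime P) F₁ ∈ maximalIdeal (Localization.AtPrime P) ∧
      algebraMap _ (Localization.AtPrime P) F₂ ∈ maximalIdeal (Localization.AtPrime P) := by
    rw [← IsLocalization.AtPrime.map_eq_maximalIdeal P (Localization.AtPrime P)]
    exact ⟨Ideal.mem_map_of_mem _ hF₁P, Ideal.mem_map_of_mem _ hF₂P⟩
  have hprime := prime_F₁ F₁ hF₁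
  have hf₁0 : algebraMap _ (Localization.AtPrime P) F₁ ≠ 0 := fun h =>
    hprime.ne_zero (hinj (by rw [map_zero]; exact h))
  -- `(F₁)·R` is prime and does not contain `F₂`
  have hspan : Ideal.span {algebraMap _ (Localization.AtPrime P) F₁} =
      (Ideal.span {F₁}).map (algebraMap (MvPolynomial (Fin 5) k) (Localization.AtPrime P)) := by
    rw [Ideal.map_span, Set.image_singleton]
  haveI : (Ideal.span {F₁}).IsPrime := (Ideal.span_singleton_prime hprime.ne_zero).mpr hprime
  have hle : Ideal.span {F₁} ≤ P := (Ideal.span_singleton_le_iff_mem _).mpr hF₁P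
  have hp₁ : (Ideal.span {algebraMap _ (Localization.AtPrime P) F₁}).IsPrime := by
    rw [hspan]
    exact Ideal.isPrime_map_of_isLocalizationAtPrime P hle
  have hnot : algebraMap _ (Localization.AtPrime P) F₂ ∉ Ideal.span {algebraMap _ (Localization.AtPrime P) F₁} := by
    intro h
    rw [hspan, IsLocalization.mem_map_algebraMap_iff P.primeCompl (Localization.AtPrime P)] at h
    obtain ⟨⟨⟨i, hi⟩, ⟨s, hs⟩⟩, h⟩ := h
    dsimp only at h
    rw [← map_mul] at h
    have h' : F₂ * s = i := hinj h
    have hdvd : F₁ ∣ F₂ * s := by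
      rw [h']
      exact Ideal.mem_span_singleton.mp hi
    rcases hprime.dvd_or_dvd hdvd with h1 | h1
    · exact F₁_not_dvd_F₂ F₁ F₂ hF₁ hF₂ h1
    · exact hs (hle (Ideal.mem_span_singleton.mpr h1))
  have hcuts := ringKrullDim_two_cuts _ _ hfm.1 hfm.2 hf₁0 hp₁ hnot
  -- `R/(F₁,F₂) = R ⧸ I·R ≅ (k[X]/I)_Q`
  have hIJ : Ideal.span {algebraMap _ (Localization.AtPrime P) F₁} ⊔ Ideal.span {algebraMap _ (Localization.AtPrime P) F₂} =
      (Ideal.ofList [F₁, F₂]).map (algebraMap (MvPolynomial (Fin 5) k) (Localization.AtPrime P)) := by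
    rw [Ideal.map_span, ← Ideal.span_union]
    congr 1
    have hset : {r : MvPolynomial (Fin 5) k | r ∈ [F₁, F₂]} = {F₁, F₂} := by
      ext r
      simp
    rw [hset, Set.image_insert_eq, Set.image_singleton, Set.singleton_union]
  obtain ⟨e₂⟩ := CIFedderAtMaximalIdeal.nonempty_quotLocalizationEquiv (MvPolynomial (Fin 5) k) (Ideal.ofList [F₁, F₂]) Q
  have hdimQ : ringKrullDim (Localization.AtPrime Q) =
      ringKrullDim (Localization.AtPrime P ⧸ (Ideal.span {algebraMap _ (Localization.AtPrime P) F₁} ⊔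
        Ideal.span {algebraMap _ (Localization.AtPrime P) F₂})) := by
    rw [← ringKrullDim_eq_of_ringEquiv e₂, hIJ]
  have h2 : (([F₁, F₂].length : ℕ) : WithBot ℕ∞) = 1 + 1 := by norm_num
  rw [hdimQ, h2, ← add_assoc, hcuts, hdimR]

end Dimension

/-! ## §3 Fedder's test at every off-vertex closed point -/

section Fedder

variable {k : Type} [Field k] [CharP k 5]

/-- **`(F₁F₂)⁴ ∉ P^[5]` at every maximal ideal `P ⊇ (F₁, F₂)` of `k[X]` missing a variable.** At the residue point
`b = (x̄ᵢ)` of `k[X]/P` one of `b_U, b_w, b_x` is non-zero (otherwise `F₁(b) = 0`, `F₂(b) = 0` force `b_y = b_Z = 0`, i.e.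
`P ⊇ (X)`), so a witness of `…PConeFedderData` gives Fedder's test over `k[X]/P`, and the residue-point dictionary (C3a)
descends it to `P`. [cite: Fedder1983, Prop. 1.7 and Prop. 2.1] -/
theorem fedder_at_offVertex_point (F₁ F₂ : MvPolynomial (Fin 5) k)
    (hF₁ : F₁ = X 0 ^ 2 + X 1 ^ 3 - X 2 * X 4) (hF₂ : F₂ = X 3 ^ 2 + X 2 * X 4 ^ 3 + X 2 ^ 3)
    (P : Ideal (MvPolynomial (Fin 5) k)) [P.IsMaximal] (hF₁P : F₁ ∈ P) (hF₂P : F₂ ∈ P)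
    (hj : ∃ j : Fin 5, (X j : MvPolynomial (Fin 5) k) ∉ P) :
    (F₁ * F₂) ^ (5 - 1) ∉ frobeniusPower 5 P := by
  haveI : Fact (Nat.Prime 5) := ⟨Nat.prime_five⟩
  letI : Field (MvPolynomial (Fin 5) k ⧸ P) := Ideal.Quotient.field P
  refine FrobeniusPowerOfFedderAt.frobeniusPower_of_fedderAt 5 k 5 (F₁ * F₂) P ?_
  set b : Fin 5 → MvPolynomial (Fin 5) k ⧸ P := fun i => Ideal.Quotient.mk P (X i) with hb
  -- evaluation at the tautological point is reduction mod `P`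
  have hev : ∀ F : MvPolynomial (Fin 5) k, MvPolynomial.aeval b F = Ideal.Quotient.mk P F := by
    intro F
    have h := MvPolynomial.aeval_unique (Ideal.Quotient.mkₐ k P)
    have hcomp : ⇑(Ideal.Quotient.mkₐ k P) ∘ MvPolynomial.X = b := rfl
    rw [hcomp] at h
    exact (DFunLike.congr_fun h F).symm
  have h1 : b 0 ^ 2 + b 1 ^ 3 - b 2 * b 4 = 0 := by
    have h := hev F₁
    rw [Ideal.Quotient.eq_zero_iff_mem.mpr hF₁P, hF₁] at h
    simpa using h
  have h2 : b 3 ^ 2 + b 2 * b 4 ^ 3 + b 2 ^ 3 = 0 := by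
    have h := hev F₂
    rw [Ideal.Quotient.eq_zero_iff_mem.mpr hF₂P, hF₂] at h
    simpa using h
  -- trichotomy
  have htri : b 4 ≠ 0 ∨ b 2 ≠ 0 ∨ b 0 ≠ 0 := by
    by_contra hcon
    push Not at hcon
    obtain ⟨h4, h2', h0⟩ := hcon
    rw [h0, h2', h4] at h1
    rw [h2', h4] at h2
    have hb1 : b 1 = 0 := by
      have : b 1 ^ 3 = 0 := by simpa using h1
      exact pow_eq_zero_iff (n := 3) (by norm_num) |>.mp this
    have hb3 : b 3 = 0 := by
      have : b 3 ^ 2 = 0 := by simpa using h2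
      exact pow_eq_zero_iff (n := 2) (by norm_num) |>.mp this
    obtain ⟨j, hjP⟩ := hj
    apply hjP
    have hall : ∀ i : Fin 5, b i = 0 := by
      intro i
      fin_cases i
      · exact h0
      · exact hb1
      · exact h2'
      · exact hb3
      · exact h4
    exact Ideal.Quotient.eq_zero_iff_mem.mp (hall j)
  rcases htri with h | h | h
  · exact PConeFedderData.pCone_fedder_U F₁ F₂ hF₁ hF₂ b h
  · exact PConeFedderData.pCone_fedder_w F₁ F₂ hF₁ hF₂ b h
  · exact PConeFedderData.pCone_fedder_x F₁ F₂ hF₁ hF₂ b h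

/-! ## §4 The clause off the vertex (hoffᵍ at `P`, `p = 5`) -/

/-- **THE CLAUSE OFF THE VERTEX FOR THE CONE OVER `P`, `char k = 5`** (= the hypothesis `hoffᵍ` of the graded-domain engine
`stub_gradedDomainConeFiModel` at `G = {F₁, F₂}`, `G := {r | r ∈ [F₁, F₂]}`): at every maximal ideal `Q` of
`k[x,y,w,Z,U]/(F₁,F₂)` missing some variable, the local ring satisfies the per-stalk clause of crux
`FInjectiveMacaulayfication` — every system of parameters is weakly regular and generates a Frobenius closed ideal. Fedder for
complete intersections at `Q` (stub-6's `CIFedderAtMaximalIdeal.ci_fedderAtMaximalIdeal`) on §2–§3. The point is F-pure but in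
general NOT regular (e.g. on the cones `L`, `C′`). [cite: Fedder1983, Prop. 1.7, Thm. 1.12 and Prop. 2.1] -/
theorem pCone_offVertex_clause_char5 (k : Type) [Field k] [CharP k 5] (F₁ F₂ : MvPolynomial (Fin 5) k)
    (hF₁ : F₁ = X 0 ^ 2 + X 1 ^ 3 - X 2 * X 4) (hF₂ : F₂ = X 3 ^ 2 + X 2 * X 4 ^ 3 + X 2 ^ 3) :
    ∀ (Q : Ideal (MvPolynomial (Fin 5) k ⧸ Ideal.span {r | r ∈ [F₁, F₂]})) [Q.IsMaximal],
      (∃ j : Fin 5, Ideal.Quotient.mk (Ideal.span {r | r ∈ [F₁, F₂]}) (MvPolynomial.X j) ∉ Q) →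
      ∀ d : ℕ, ringKrullDim (Localization.AtPrime Q) = d → ∀ s : Fin d → Localization.AtPrime Q,
        (Ideal.span (Set.range s)).radical.IsMaximal →
          RingTheory.Sequence.IsWeaklyRegular (Localization.AtPrime Q) (List.ofFn s) ∧
          ∀ y : Localization.AtPrime Q, (∃ e : ℕ, y ^ 5 ^ e ∈ Ideal.span
            ((fun z : Localization.AtPrime Q => z ^ 5 ^ e) ''
              (Ideal.span (Set.range s) : Set (Localization.AtPrime Q)))) → y ∈ Ideal.span (Set.range s) := by
  intro Q _ hj
  haveI : Fact (Nat.Prime 5) := ⟨Nat.prime_five⟩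
  haveI hPmax : (Q.comap (Ideal.Quotient.mk (Ideal.ofList [F₁, F₂]))).IsMaximal :=
    Ideal.comap_isMaximal_of_surjective _ Ideal.Quotient.mk_surjective
  -- generators of `P = Q ∩ k[X]`
  obtain ⟨m, a, ha⟩ := Submodule.fg_iff_exists_fin_generating_family.mp
    (IsNoetherian.noetherian (Q.comap (Ideal.Quotient.mk (Ideal.ofList [F₁, F₂]))))
  have hsub : Ideal.ofList [F₁, F₂] ≤ Q.comap (Ideal.Quotient.mk (Ideal.ofList [F₁, F₂])) := fun r hr => by
    rw [Ideal.mem_comap, Ideal.Quotient.eq_zero_iff_mem.mpr hr]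
    exact Q.zero_mem
  have hF₁P : F₁ ∈ Q.comap (Ideal.Quotient.mk (Ideal.ofList [F₁, F₂])) := hsub (Ideal.subset_span (by simp))
  have hF₂P : F₂ ∈ Q.comap (Ideal.Quotient.mk (Ideal.ofList [F₁, F₂])) := hsub (Ideal.subset_span (by simp))
  have hj' : ∃ j : Fin 5, (X j : MvPolynomial (Fin 5) k) ∉ Q.comap (Ideal.Quotient.mk (Ideal.ofList [F₁, F₂])) := by
    obtain ⟨j, hj⟩ := hj
    exact ⟨j, fun h => hj (Ideal.mem_comap.mp h)⟩
  have hfedP := fedder_at_offVertex_point F₁ F₂ hF₁ hF₂ _ hF₁P hF₂P hj'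
  -- the polynomial-level test against the generators `a`
  have hfed : [F₁, F₂].prod ^ (5 - 1) ∉ Ideal.span (Set.range fun i : Fin m => a i ^ 5) := by
    intro h
    apply hfedP
    have hle : Ideal.span (Set.range fun i : Fin m => a i ^ 5) ≤
        frobeniusPower 5 (Q.comap (Ideal.Quotient.mk (Ideal.ofList [F₁, F₂]))) := by
      rw [Ideal.span_le]
      rintro _ ⟨i, rfl⟩
      have hai : a i ∈ Q.comap (Ideal.Quotient.mk (Ideal.ofList [F₁, F₂])) := by
        rw [← ha]
        exact Submodule.subset_span ⟨i, rfl⟩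
      exact pow_mem_frobeniusPower hai
    have hprod : [F₁, F₂].prod = F₁ * F₂ := by simp
    rw [hprod] at h
    exact hle h
  exact CIFedderAtMaximalIdeal.ci_fedderAtMaximalIdeal k 5 m 5 a [F₁, F₂] Q ha.symm hfed
    (ringKrullDim_stalk_add_two F₁ F₂ hF₁ hF₂ Q)

end Fedder

end Summit.ResolutionOfSingularities.ResolutionOfSingularities.Theorems.FInjectiveMacaulayfication.PConeOffVertex

end
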